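import Summits.QuantumFields.BalabanUV.T4Continuum.Support.VariationalCovariantScalarPair
import Summits.QuantumFields.BalabanUV.T4Continuum.Support.VariationalCovariantRegularity
import Summits.QuantumFields.BalabanUV.T4Continuum.Support.VariationalCovariantBochner

/-!
# T⁴ programme, spine node NE2 (U1a), lane P2 — leaf REG⁺ of the variational route, file 4: THE `hREG` BINDER OF THE SCALAR
# CANONICAL-PAIR BRACKET IN THE CAPSTONE'S CURRENCY (physical units `Sc`, `qW`, `Qk` of `VariationalCovariantScalarPair`),
# for the three regularity functionals a ONE⁺ supplier may use: covariant Laplacian, full forward covariant Hessian, forward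
# directional second differences (`t4/skeletons/NE2-t4-ne2-p2.md` v0.7 §2.C / §7 supplier leaf s6; cell `pub-balaban`,
# NE2 formalisation swarm, leaf prover 09 gen 3)

HONEST FRAMING (T4-DAG p. 1).  Rung (B)+1 only — NOT infinite volume, NOT a mass gap, NOT Clay.  Node NE2 is NOT IN PRINT and NOT
proved here.  MODEL LEVEL: U(1) bond phases `Rc` (unit modulus where stated, plaquette defect `a` where stated) and UNIT-MODULUS site
transports `T` on the level-`n` torus, DATA; scalar sector; ONE level.  This file is WIRING: files 2/3 of the leaf
(`VariationalCovariantRegularity.nsq_negLap_le_of_isMin`, `VariationalCovariantBochner.hessian_le`) re-expressed in the currency of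
`VariationalCovariantScalarPair.scalar_pair_bracket` (p211992), whose binder is
`hREG : ∀ μ f, Qk f = μ → (∀ g, Qk g = μ → Sc f ≤ Sc g) → ρ f ≤ C_R·(Sc f + nsq μ)`.  No `sorry`; axioms standard; no `def … : Prop`
fact; nothing printed is a hypothesis.  HONEST DEPENDENCY (cell, verbatim): continuum YM on T⁴ ⇐ BetaPertH ∧ nine spine estimates
(0/9 proved); BetaPertH ⇐ (D1) ∧ (D4) ∧ CAP+tail; G-an2-4 gates asym, D1 and NE2/3/4.

THE STATEMENTS (`Sc f = n²/n^d·Σ_μ dirU`, `qW f = n^{−d}·nsq f`, `Qk = Q_T`; `Λ` = the UB⁺ constant of the binder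
`hUBc : ∀ μ, ∃ f, Qk f = μ ∧ Sc f ≤ Λ·nsq μ` — supplied by `Support/VariationalCovariantUpperBound` (leaf-04 gen 2, p212172), NOT here):
 * `rhoLap f := n⁴/n^d·nsq (D†D f)` — **`hREG_lap`**: `C_R = Λ` (indeed `rhoLap f ≤ Λ·Sc f`, `rhoLap_le_of_isMin`; no P⁺ needed);
 * `rhoHess f := n⁴/n^d·Σ_{μ,ν} nsq (D_μD_ν f)` (leaf ONE⁺'s announced functional, full FORWARD covariant Hessian) — for every `f`
   `rhoHess f ≤ 2·rhoLap f + 2d·(a n²)·Sc f + d²·(a n²)²·qW f` (`rhoHess_le`, Bochner), hence with the P⁺ binder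
   `hPc : ∀ f, qW f ≤ C_P·(Sc f + nsq (Qk f))` (the capstone's `qW_le_coarse`, `C_P = 1088d + 128`; no sign needed) — **`hREG_hess`**:
   `C_R = 2Λ + 2d·(a n²) + d²·(a n²)²·C_P` (for the unit-smooth class `a ≍ α·n⁻²`, so `a n² ≍ α`: k-UNIFORM);
 * `rhoDir f := n⁴/n^d·Σ_ν nsq (D_νD_ν f)` (the U = 1 engine's forward directional functional) — `rhoDir ≤ rhoHess` (`rhoDir_le_rhoHess`),
   **`hREG_dir`** with the same `C_R`.
No NE3, no propagator localisation.
-/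

noncomputable section

namespace Summit.QuantumFields.BalabanUV.T4Continuum.VariationalCovariantRegularityScalar

open Finset
open Literature.MathematicalPhysics.QuantumFieldTheory.Balaban1983to89
open Literature.MathematicalPhysics.QuantumFieldTheory.Balaban1983to89.B5Prop11Plancherel (Tor fine unitVec)
open Literature.MathematicalPhysics.QuantumFieldTheory.Balaban1983to89.B5Prop11Lower (nsq nsq_nonneg)
open Summit.QuantumFields.BalabanUV.T4Continuum.VariationalCovariantFederbush (cD dirU)
open Summit.QuantumFields.BalabanUV.T4Continuum.VariationalCovariantPoincare (QT dirR)
open Summit.QuantumFields.BalabanUV.T4Continuum.VariationalCovariantScalarPair (Sc qW Qk Sc_nonneg qW_nonneg dirR_eq_sum_dirU)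
open Summit.QuantumFields.BalabanUV.T4Continuum.VariationalCovariantDirichletForm (negLap)
open Summit.QuantumFields.BalabanUV.T4Continuum.VariationalCovariantRegularity (nsq_negLap_le_of_isMin)
open Summit.QuantumFields.BalabanUV.T4Continuum.VariationalCovariantBochner (Dir hessian_le sum_nsq_Dir_eq)

variable {d : ℕ} (n : ℕ) [NeZero n] (M : Fin d → ℕ) [hM : ∀ μ, NeZero (M μ)]

/-! ## §1 The three regularity functionals in physical units -/

/-- `ρ_Lap f = n⁴/n^d·Σ_x |(D_{Rc}†D_{Rc} f)(x)|²` — the `L²`-norm² of the covariant Laplacian in physical units. [folklore] -/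
def rhoLap (Rc : Tor (fine n M) → Fin d → ℂ) (f : Tor (fine n M) → ℂ) : ℝ :=
  (n : ℝ) ^ 4 / (n : ℝ) ^ d * nsq (negLap (fine n M) Rc f)

/-- `ρ_Hess f = n⁴/n^d·Σ_{μ,ν,x} |(D_μ D_ν f)(x)|²` — the full FORWARD covariant Hessian in physical units. [folklore] -/
def rhoHess (Rc : Tor (fine n M) → Fin d → ℂ) (f : Tor (fine n M) → ℂ) : ℝ :=
  (n : ℝ) ^ 4 / (n : ℝ) ^ d * ∑ μ, ∑ ν, nsq (Dir (fine n M) Rc μ (Dir (fine n M) Rc ν f))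

/-- `ρ_dir f = n⁴/n^d·Σ_{ν,x} |(D_ν D_ν f)(x)|²` — forward directional second covariant differences in physical units. [folklore] -/
def rhoDir (Rc : Tor (fine n M) → Fin d → ℂ) (f : Tor (fine n M) → ℂ) : ℝ :=
  (n : ℝ) ^ 4 / (n : ℝ) ^ d * ∑ ν, nsq (Dir (fine n M) Rc ν (Dir (fine n M) Rc ν f))

/-- `Sc` is `n²/n^d·dirR`. [folklore] -/
theorem Sc_eq_dirR (Rc : Tor (fine n M) → Fin d → ℂ) (f : Tor (fine n M) → ℂ) :
    Sc n M Rc f = (n : ℝ) ^ 2 / (n : ℝ) ^ d * dirR n M Rc f := rfl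

omit [NeZero n] hM in
/-- `Qk` is `Q_T`. [folklore] -/
theorem Qk_eq_QT (T f : Tor (fine n M) → ℂ) : Qk n M T f = QT n M T f := rfl

/-! ## §2 `hREG` for the covariant Laplacian: `C_R = Λ` -/

/-- the UB⁺ binder in `Sc`-units gives the lattice-unit binder with `Λ_lat = Λ·n^d/n²`. [folklore] -/
theorem hUB_lat {Rc : Tor (fine n M) → Fin d → ℂ} {T : Tor (fine n M) → ℂ} {Λ : ℝ}
    (hUBc : ∀ μ : Tor M → ℂ, ∃ f, Qk n M T f = μ ∧ Sc n M Rc f ≤ Λ * nsq μ) (ν : Tor M → ℂ) :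
    ∃ lam : Tor (fine n M) → ℂ, QT n M T lam = ν ∧ dirR n M Rc lam ≤ Λ * (n : ℝ) ^ d / (n : ℝ) ^ 2 * nsq ν := by
  have hn : (0 : ℝ) < (n : ℝ) := by exact_mod_cast Nat.pos_of_ne_zero (NeZero.ne n)
  obtain ⟨f, hf, hb⟩ := hUBc ν
  refine ⟨f, hf, ?_⟩
  rw [Sc_eq_dirR] at hb
  have hnd : (0 : ℝ) < (n : ℝ) ^ d := by positivity
  have hn2 : (0 : ℝ) < (n : ℝ) ^ 2 := by positivity
  rw [div_mul_eq_mul_div, div_le_iff₀ hnd] at hb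
  rw [div_mul_eq_mul_div, le_div_iff₀ hn2]
  linarith

/-- **REG⁺ (Laplacian form) in physical units**: at a constrained minimiser `ρ_Lap f ≤ Λ·Sc f`. [folklore] -/
theorem rhoLap_le_of_isMin {Rc : Tor (fine n M) → Fin d → ℂ} {T : Tor (fine n M) → ℂ} (hT1 : ∀ x, ‖T x‖ = 1) {Λ : ℝ}
    (hΛ : 0 ≤ Λ) (hUBc : ∀ μ : Tor M → ℂ, ∃ f, Qk n M T f = μ ∧ Sc n M Rc f ≤ Λ * nsq μ)
    {μ : Tor M → ℂ} {f : Tor (fine n M) → ℂ} (hf : Qk n M T f = μ) (hmin : ∀ g, Qk n M T g = μ → Sc n M Rc f ≤ Sc n M Rc g) :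
    rhoLap n M Rc f ≤ Λ * Sc n M Rc f := by
  have hn : (0 : ℝ) < (n : ℝ) := by exact_mod_cast Nat.pos_of_ne_zero (NeZero.ne n)
  have hnd : (0 : ℝ) < (n : ℝ) ^ d := by positivity
  have hn2 : (0 : ℝ) < (n : ℝ) ^ 2 := by positivity
  have hmin' : ∀ g, QT n M T g = μ → dirR n M Rc f ≤ dirR n M Rc g := by
    intro g hg
    have h := hmin g hg
    rw [Sc_eq_dirR, Sc_eq_dirR] at h
    exact le_of_mul_le_mul_left h (by positivity)
  have h := nsq_negLap_le_of_isMin n M hT1 Rc (Λ := Λ * (n : ℝ) ^ d / (n : ℝ) ^ 2) (by positivity) (hUB_lat n M hUBc) hf hmin'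
  unfold rhoLap
  rw [Sc_eq_dirR]
  calc (n : ℝ) ^ 4 / (n : ℝ) ^ d * nsq (negLap (fine n M) Rc f)
      ≤ (n : ℝ) ^ 4 / (n : ℝ) ^ d * (Λ * (n : ℝ) ^ d / (n : ℝ) ^ 2 / (n : ℝ) ^ d * dirR n M Rc f) :=
        mul_le_mul_of_nonneg_left h (by positivity)
    _ = Λ * ((n : ℝ) ^ 2 / (n : ℝ) ^ d * dirR n M Rc f) := by field_simp

/-- **`hREG` LITERAL for `ρ = ρ_Lap`** (binder of `VariationalCovariantScalarPair.scalar_pair_bracket`): `C_R = Λ`. [folklore] -/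
theorem hREG_lap {Rc : Tor (fine n M) → Fin d → ℂ} {T : Tor (fine n M) → ℂ} (hT1 : ∀ x, ‖T x‖ = 1) {Λ : ℝ} (hΛ : 0 ≤ Λ)
    (hUBc : ∀ μ : Tor M → ℂ, ∃ f, Qk n M T f = μ ∧ Sc n M Rc f ≤ Λ * nsq μ) :
    ∀ (μ : Tor M → ℂ) (f : Tor (fine n M) → ℂ), Qk n M T f = μ → (∀ g, Qk n M T g = μ → Sc n M Rc f ≤ Sc n M Rc g) →
      rhoLap n M Rc f ≤ Λ * (Sc n M Rc f + nsq μ) := by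
  intro μ f hf hmin
  have h := rhoLap_le_of_isMin n M hT1 hΛ hUBc hf hmin
  have : Λ * Sc n M Rc f ≤ Λ * (Sc n M Rc f + nsq μ) := mul_le_mul_of_nonneg_left (by linarith [nsq_nonneg μ]) hΛ
  linarith

/-! ## §3 `hREG` for the full forward Hessian and for the directional functional -/

/-- **Bochner in physical units** (every `f`): `ρ_Hess f ≤ 2ρ_Lap f + 2d·(a n²)·Sc f + d²·(a n²)²·qW f`. [folklore] -/
theorem rhoHess_le {Rc : Tor (fine n M) → Fin d → ℂ} (hR1 : ∀ x μ, ‖Rc x μ‖ = 1) {a : ℝ} (ha : 0 ≤ a)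
    (hP : ∀ x μ ν, ‖Rc x μ * Rc (x + unitVec (fine n M) μ) ν - Rc x ν * Rc (x + unitVec (fine n M) ν) μ‖ ≤ a)
    (f : Tor (fine n M) → ℂ) :
    rhoHess n M Rc f ≤ 2 * rhoLap n M Rc f + 2 * d * (a * (n : ℝ) ^ 2) * Sc n M Rc f + (d : ℝ) ^ 2 * (a * (n : ℝ) ^ 2) ^ 2 * qW n M f := by
  have hn : (0 : ℝ) < (n : ℝ) := by exact_mod_cast Nat.pos_of_ne_zero (NeZero.ne n)
  have hnd : (n : ℝ) ^ d ≠ 0 := by positivity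
  have h := hessian_le (fine n M) hR1 ha hP f
  rw [sum_nsq_Dir_eq, ← dirR_eq_sum_dirU] at h
  unfold rhoHess rhoLap qW
  rw [Sc_eq_dirR]
  have h2 := mul_le_mul_of_nonneg_left h (show (0 : ℝ) ≤ (n : ℝ) ^ 4 / (n : ℝ) ^ d by positivity)
  refine h2.trans (le_of_eq ?_)
  field_simp

/-- `ρ_dir ≤ ρ_Hess` (the diagonal of a sum of nonnegatives). [folklore] -/
theorem rhoDir_le_rhoHess (Rc : Tor (fine n M) → Fin d → ℂ) (f : Tor (fine n M) → ℂ) :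
    rhoDir n M Rc f ≤ rhoHess n M Rc f := by
  unfold rhoDir rhoHess
  refine mul_le_mul_of_nonneg_left ?_ (by positivity)
  exact sum_le_sum fun ν _ =>
    single_le_sum (f := fun μ => nsq (Dir (fine n M) Rc ν (Dir (fine n M) Rc μ f))) (fun μ _ => nsq_nonneg _) (mem_univ ν)

/-- **`hREG` LITERAL for `ρ = ρ_Hess`**: with the UB⁺ binder `hUBc` (constant `Λ`) and the P⁺ binder `hPc` (constant `C_P`),
`C_R = 2Λ + 2d·(a n²) + d²·(a n²)²·C_P`. [folklore] -/
theorem hREG_hess {Rc : Tor (fine n M) → Fin d → ℂ} {T : Tor (fine n M) → ℂ} (hT1 : ∀ x, ‖T x‖ = 1)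
    (hR1 : ∀ x μ, ‖Rc x μ‖ = 1) {a : ℝ} (ha : 0 ≤ a)
    (hP : ∀ x μ ν, ‖Rc x μ * Rc (x + unitVec (fine n M) μ) ν - Rc x ν * Rc (x + unitVec (fine n M) ν) μ‖ ≤ a)
    {Λ CP : ℝ} (hΛ : 0 ≤ Λ)
    (hUBc : ∀ μ : Tor M → ℂ, ∃ f, Qk n M T f = μ ∧ Sc n M Rc f ≤ Λ * nsq μ)
    (hPc : ∀ f, qW n M f ≤ CP * (Sc n M Rc f + nsq (Qk n M T f))) :
    ∀ (μ : Tor M → ℂ) (f : Tor (fine n M) → ℂ), Qk n M T f = μ → (∀ g, Qk n M T g = μ → Sc n M Rc f ≤ Sc n M Rc g) →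
      rhoHess n M Rc f ≤ (2 * Λ + 2 * d * (a * (n : ℝ) ^ 2) + (d : ℝ) ^ 2 * (a * (n : ℝ) ^ 2) ^ 2 * CP) * (Sc n M Rc f + nsq μ) := by
  intro μ f hf hmin
  have h1 := rhoHess_le n M hR1 ha hP f
  have h2 := rhoLap_le_of_isMin n M hT1 hΛ hUBc hf hmin
  have h3 : qW n M f ≤ CP * (Sc n M Rc f + nsq μ) := by rw [← hf]; exact hPc f
  have hZ0 : 0 ≤ nsq μ := nsq_nonneg μ
  have hα : 0 ≤ a * (n : ℝ) ^ 2 := by positivity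
  have hd : (0 : ℝ) ≤ d := Nat.cast_nonneg d
  set α : ℝ := a * (n : ℝ) ^ 2 with hαdef
  set S : ℝ := Sc n M Rc f
  set Z : ℝ := nsq μ
  have e1 : (d : ℝ) ^ 2 * α ^ 2 * qW n M f ≤ (d : ℝ) ^ 2 * α ^ 2 * (CP * (S + Z)) := mul_le_mul_of_nonneg_left h3 (by positivity)
  have p1 : 0 ≤ Λ * Z := mul_nonneg hΛ hZ0
  have p2 : 0 ≤ (d : ℝ) * α * Z := mul_nonneg (mul_nonneg hd hα) hZ0
  have key : (2 * Λ + 2 * d * α + (d : ℝ) ^ 2 * α ^ 2 * CP) * (S + Z)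
      = 2 * (Λ * S) + 2 * d * α * S + (d : ℝ) ^ 2 * α ^ 2 * (CP * (S + Z)) + (2 * (Λ * Z) + 2 * ((d : ℝ) * α * Z)) := by ring
  rw [key]
  linarith

/-- **`hREG` LITERAL for `ρ = ρ_dir`** (same constant). [folklore] -/
theorem hREG_dir {Rc : Tor (fine n M) → Fin d → ℂ} {T : Tor (fine n M) → ℂ} (hT1 : ∀ x, ‖T x‖ = 1)
    (hR1 : ∀ x μ, ‖Rc x μ‖ = 1) {a : ℝ} (ha : 0 ≤ a)
    (hP : ∀ x μ ν, ‖Rc x μ * Rc (x + unitVec (fine n M) μ) ν - Rc x ν * Rc (x + unitVec (fine n M) ν) μ‖ ≤ a)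
    {Λ CP : ℝ} (hΛ : 0 ≤ Λ)
    (hUBc : ∀ μ : Tor M → ℂ, ∃ f, Qk n M T f = μ ∧ Sc n M Rc f ≤ Λ * nsq μ)
    (hPc : ∀ f, qW n M f ≤ CP * (Sc n M Rc f + nsq (Qk n M T f))) :
    ∀ (μ : Tor M → ℂ) (f : Tor (fine n M) → ℂ), Qk n M T f = μ → (∀ g, Qk n M T g = μ → Sc n M Rc f ≤ Sc n M Rc g) →
      rhoDir n M Rc f ≤ (2 * Λ + 2 * d * (a * (n : ℝ) ^ 2) + (d : ℝ) ^ 2 * (a * (n : ℝ) ^ 2) ^ 2 * CP) * (Sc n M Rc f + nsq μ) :=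
  fun μ f hf hmin => (rhoDir_le_rhoHess n M Rc f).trans (hREG_hess n M hT1 hR1 ha hP hΛ hUBc hPc μ f hf hmin)

end Summit.QuantumFields.BalabanUV.T4Continuum.VariationalCovariantRegularityScalar

end
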